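import Summits.CriticalPhenomena.PercolationContinuityZ3.Theorems.SahiMasterFamilyLightAtomsPairs
import Summits.CriticalPhenomena.PercolationContinuityZ3.Theorems.SahiMasterFamilyStrictHierarchyPoset

/-!
# Strictness of Sahi's hierarchy at every order, V: the witness law `μ_w` on `P_w` — parameters and the pair sum

Support file of the master-family programme (crux `NoHeavyLowerTail`, stmt-CriticalPhenomena-4575; cell `prim-masterthm`,
seat P4, unit `prim-masterthm-p4-g4`).  The parameters of the witness of `SahiMasterFamilyStrictHierarchy`:

* `epsW w = 1/(8 (w+2)^{w+4})`, `QW w = w(w−1)/2`, `topW w = ε²(Q − ½)`, `lawW w = muW w ε t` (mass `ε` on each atom, `t` on `⊤`);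
  `eps_mul_le` — the single numerical fact used downstream: `ε·X ≤ 3/16` whenever `X ≤ 3 (w+2)^{w+3}`; `topW_bounds`
  (`0 < t ≤ ε² Q`, `t ≤ ε`); `lawW_nonneg`, `sum_lawW`, `lawW_light` (atoms of a proper up-set have mass `≤ ε`);
* `sum_offDiag_PW` — a sum over ordered pairs of distinct points of `P_w` with vanishing `⊥`-terms splits into atom–atom and
  top–atom pairs; `pairTotal_eq` — the second-order pair sum `Σ_{(a,b)} μa μb·rpairSum (rows a) (rows b)` of a family of proper
  up-sets is `ε²·Σ_{j≠j'} rpairSum (R_j, R_j') + tε·Σ_j (…)`; `mem_common_iff` (atoms common to all members), `tail_le`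
  (`#(∏U_i)·ε³(n+1)! ≤ ε³ (w+2)^{n+1} (n+1)·n!`).
HONEST FRAMING: bookkeeping and arithmetic; [this work].
-/

namespace Summit.CriticalPhenomena.PercolationContinuityZ3.Theorems

namespace SahiStrictHierarchy

open Finset Function
open Literature.Combinatorics.Sahi2008 SahiRepresentativeForm SahiPairFunctional SahiLightAtoms PW

variable {w : ℕ}

/-! ### Parameters -/

/-- `ε_w = 1/(8 (w+2)^{w+4})`. [this work] -/
noncomputable def epsW (w : ℕ) : ℝ := 1 / (8 * ((w : ℝ) + 2) ^ (w + 4))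

/-- `Q_w = C(w,2) = w(w−1)/2` as a real number. [this work] -/
noncomputable def QW (w : ℕ) : ℝ := (w : ℝ) * ((w : ℝ) - 1) / 2

/-- `t_w = ε_w² (Q_w − ½)`. [this work] -/
noncomputable def topW (w : ℕ) : ℝ := epsW w ^ 2 * (QW w - 1 / 2)

/-- The witness law `μ_w` on `P_w`. [this work] -/
noncomputable def lawW (w : ℕ) : PW w → ℝ := muW w (epsW w) (topW w)

/-- `(w:ℝ) + 2 ≥ 2`. [this work] -/
theorem two_le_W (w : ℕ) : (2 : ℝ) ≤ (w : ℝ) + 2 := by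
  have := (w : ℕ).cast_nonneg (α := ℝ); linarith

/-- `ε > 0`. [this work] -/
theorem epsW_pos (w : ℕ) : 0 < epsW w := by
  unfold epsW
  have := two_le_W w
  positivity

/-- `ε · 8 (w+2)^{w+4} = 1`. [this work] -/
theorem epsW_mul (w : ℕ) : epsW w * (8 * ((w : ℝ) + 2) ^ (w + 4)) = 1 := by
  unfold epsW
  have : (0 : ℝ) < 8 * ((w : ℝ) + 2) ^ (w + 4) := by have := two_le_W w; positivity
  field_simp

/-- Powers of `W = w + 2` are monotone in the exponent. [this work] -/
theorem W_pow_le_pow {a b : ℕ} (h : a ≤ b) : ((w : ℝ) + 2) ^ a ≤ ((w : ℝ) + 2) ^ b :=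
  pow_le_pow_right₀ (by have := two_le_W w; linarith) h

/-- `2^a ≤ W^a`. [this work] -/
theorem two_pow_le_W_pow (a : ℕ) : (2 : ℝ) ^ a ≤ ((w : ℝ) + 2) ^ a :=
  pow_le_pow_left₀ (by norm_num) (two_le_W w) a

/-- **The master numerical inequality**: `ε · X ≤ 3/16` whenever `X ≤ 3 (w+2)^{w+3}`. [this work] -/
theorem eps_mul_le {X : ℝ} (hX : X ≤ 3 * ((w : ℝ) + 2) ^ (w + 3)) : epsW w * X ≤ 3 / 16 := by
  have hW := two_le_W w
  have hε := epsW_pos w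
  have hmul := epsW_mul w
  have h1 : epsW w * X ≤ epsW w * (3 * ((w : ℝ) + 2) ^ (w + 3)) := mul_le_mul_of_nonneg_left hX hε.le
  set Y : ℝ := epsW w * (3 * ((w : ℝ) + 2) ^ (w + 3)) with hY
  have hY0 : 0 ≤ Y := mul_nonneg hε.le (by positivity)
  have h2 : Y * (8 * ((w : ℝ) + 2)) = 3 := by
    have : Y * (8 * ((w : ℝ) + 2)) = 3 * (epsW w * (8 * ((w : ℝ) + 2) ^ (w + 4))) := by rw [hY]; ring
    rw [this, hmul, mul_one]
  have h3 : Y ≤ 3 / 16 := by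
    rw [le_div_iff₀ (by norm_num : (0 : ℝ) < 16)]
    have : Y * 16 ≤ Y * (8 * ((w : ℝ) + 2)) := mul_le_mul_of_nonneg_left (by linarith) hY0
    linarith
  linarith

/-- `ε ≤ 1`. [this work] -/
theorem epsW_le_one (w : ℕ) : epsW w ≤ 1 := by
  have h := eps_mul_le (w := w) (X := 1) (by
    have := W_pow_le_pow (w := w) (Nat.zero_le (w + 3)); simp only [pow_zero] at this; linarith)
  linarith

/-- `ε · (w+2)^5 ≤ 1` (room for the quadratic terms). [this work] -/
theorem epsW_mul_W_le_one (hw : 2 ≤ w) : epsW w * ((w : ℝ) + 2) ^ 5 ≤ 1 := by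
  have h := eps_mul_le (w := w) (X := ((w : ℝ) + 2) ^ 5) (by
    have := W_pow_le_pow (w := w) (show 5 ≤ w + 3 by omega)
    have h0 : (0:ℝ) ≤ ((w : ℝ) + 2) ^ (w + 3) := by positivity
    linarith)
  linarith

/-- `0 ≤ Q`, `Q ≤ (w+2)^2`. [this work] -/
theorem QW_le (w : ℕ) : 0 ≤ QW w ∧ QW w ≤ ((w : ℝ) + 2) ^ 2 := by
  unfold QW
  have := (w : ℕ).cast_nonneg (α := ℝ)
  constructor
  · rcases Nat.eq_zero_or_pos w with rfl | h
    · simp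
    · have : (1 : ℝ) ≤ w := by exact_mod_cast h
      nlinarith
  · nlinarith

/-- `Q ≥ 1` for `w ≥ 2`. [this work] -/
theorem one_le_QW (hw : 2 ≤ w) : 1 ≤ QW w := by
  unfold QW
  have : (2 : ℝ) ≤ w := by exact_mod_cast hw
  nlinarith

/-- `2 Q = w² − w` (so `Q = C(w,2)`). [this work] -/
theorem two_mul_QW (w : ℕ) : 2 * QW w = (w : ℝ) * w - w := by
  unfold QW; ring

/-- `0 < t ≤ ε² Q`, and `t ≤ ε`. [this work] -/
theorem topW_bounds (hw : 2 ≤ w) : 0 < topW w ∧ topW w ≤ epsW w ^ 2 * QW w ∧ topW w ≤ epsW w := by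
  have hQ := one_le_QW hw
  have hQ' := (QW_le w).2
  have hε := epsW_pos w
  have h5 := epsW_mul_W_le_one hw
  unfold topW
  refine ⟨mul_pos (pow_pos hε 2) (by linarith), by nlinarith, ?_⟩
  have hW := two_le_W w
  have h2 : ((w : ℝ) + 2) ^ 2 ≤ ((w : ℝ) + 2) ^ 5 := W_pow_le_pow (by norm_num)
  calc epsW w ^ 2 * (QW w - 1 / 2) ≤ epsW w ^ 2 * ((w : ℝ) + 2) ^ 5 := by nlinarith
    _ = epsW w * (epsW w * ((w : ℝ) + 2) ^ 5) := by ring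
    _ ≤ epsW w * 1 := mul_le_mul_of_nonneg_left h5 hε.le
    _ = epsW w := mul_one _

/-- The witness law is a probability weight. [this work] -/
theorem lawW_nonneg (hw : 2 ≤ w) (x : PW w) : 0 ≤ lawW w x := by
  have ht := topW_bounds hw
  have hε := epsW_pos w
  refine muW_nonneg hε.le ht.1.le ?_ x
  -- `w ε + t ≤ (w+3) ε ≤ 1`
  have h1 : ((w : ℝ) + 3) * epsW w ≤ 3 / 16 := by
    rw [mul_comm]
    refine eps_mul_le ?_
    have := W_pow_le_pow (w := w) (show 1 ≤ w + 3 by omega)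
    rw [pow_one] at this
    linarith
  linarith [ht.2.2]

/-- Total mass one. [this work] -/
theorem sum_lawW (w : ℕ) : ∑ x, lawW w x = 1 := sum_muW _ _

/-- Atoms of a proper up-set are light (mass in `[0, ε]`). [this work] -/
theorem lawW_light (hw : 2 ≤ w) {U : Finset (PW w)} (hU : IsUpperSet (U : Set (PW w))) (hne : U ≠ univ) :
    ∀ a ∈ U, 0 ≤ lawW w a ∧ lawW w a ≤ epsW w :=
  muW_light (topW_bounds hw).1.le (topW_bounds hw).2.2 hU hne

/-! ### Sums over ordered pairs of points of `P_w` -/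

/-- A sum over ordered pairs of distinct elements as a double sum with the diagonal set to zero. [folklore] -/
theorem sum_offDiag_eq_sum_sum {ι : Type*} [Fintype ι] [DecidableEq ι] (H : ι → ι → ℝ) :
    ∑ p ∈ (univ : Finset ι).offDiag, H p.1 p.2 = ∑ a, ∑ b, if a = b then 0 else H a b := by
  have h1 : ∑ p ∈ (univ : Finset ι).offDiag, H p.1 p.2 =
      ∑ p ∈ (univ : Finset ι).offDiag, (if p.1 = p.2 then 0 else H p.1 p.2) :=
    sum_congr rfl fun p hp => by rw [if_neg (mem_offDiag.1 hp).2.2]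
  rw [h1, sum_subset (subset_univ _) fun p _ hp => ?_, ← univ_product_univ, sum_product]
  rw [mem_offDiag] at hp
  simp only [mem_univ, true_and, not_not] at hp
  rw [if_pos hp]

/-- A sum over ordered pairs of distinct points of `P_w` whose `⊥`-terms vanish splits into atom–atom pairs and the `2w`
top–atom pairs. [this work] -/
theorem sum_offDiag_PW (G : PW w → PW w → ℝ) (hb1 : ∀ b, G bot b = 0) (hb2 : ∀ a, G a bot = 0) :
    ∑ p ∈ (univ : Finset (PW w)).offDiag, G p.1 p.2 =
      ∑ q ∈ (univ : Finset (Fin w)).offDiag, G (mid q.1) (mid q.2) + ∑ j, (G top (mid j) + G (mid j) top) := by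
  have h1 := sum_offDiag_eq_sum_sum G
  have h2 := sum_offDiag_eq_sum_sum (fun j j' : Fin w => G (mid j) (mid j'))
  rw [h1, h2, PW.sum_univ]
  simp only [PW.sum_univ, hb1, hb2, ite_self, if_true, sum_const_zero, zero_add, add_zero, reduceCtorEq, if_false,
    mid.injEq]
  rw [sum_add_distrib, sum_add_distrib]
  ring

/-! ### Set-up for a family of proper nonempty up-sets -/

section Family

variable (hw : 2 ≤ w) {n : ℕ} (U : Fin (n + 1) → Finset (PW w))
  (hU : ∀ i, IsUpperSet ((U i : Finset (PW w)) : Set (PW w))) (hprop : ∀ i, U i ≠ univ) (hne : ∀ i, (U i).Nonempty)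

include hU hprop in
/-- `⊥` is in no member, so `rows U ⊥ = ∅`. [this work] -/
theorem rows_bot : rows U bot = ∅ := by
  rw [rows, filter_eq_empty_iff]
  intro i _
  exact bot_not_mem (hU i) (hprop i)

include hU hne in
/-- `⊤` is in every member, so `rows U ⊤ = univ`. [this work] -/
theorem rows_top : rows U top = univ := by
  rw [rows, filter_eq_self]
  intro i _
  exact top_mem_of_isUpperSet (hU i) (hne i)

/-- With an empty column the rooted pair functional vanishes (left). [this work] -/
theorem rpairSum_empty_left (R : Finset (Fin (n + 1))) : rpairSum ∅ R = 0 := by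
  rw [rpairSum, sum_eq_zero]
  intro B hB
  rw [mem_radm] at hB
  exact absurd (hB.2.2.1 hB.1) (by simp)

/-- With an empty column the rooted pair functional vanishes (right). [this work] -/
theorem rpairSum_empty_right (R : Finset (Fin (n + 1))) : rpairSum R ∅ = 0 := by
  rw [rpairSum, sum_eq_zero]
  intro B hB
  rw [mem_radm] at hB
  obtain ⟨-, hBu, -, h⟩ := hB
  exfalso
  apply hBu
  have h' : univ \ B = ∅ := subset_empty.1 h
  rw [sdiff_eq_empty_iff_subset] at h'
  exact univ_subset_iff.1 h'

include hU hprop in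
/-- **The pair sum of `P_w`**: atom–atom pairs with weight `ε²`, top–atom pairs with weight `tε`. [this work] -/
theorem pairTotal_eq :
    ∑ p ∈ (univ : Finset (PW w)).offDiag, lawW w p.1 * lawW w p.2 * (rpairSum (rows U p.1) (rows U p.2) : ℝ) =
      epsW w ^ 2 * ∑ q ∈ (univ : Finset (Fin w)).offDiag, (rpairSum (rows U (mid q.1)) (rows U (mid q.2)) : ℝ) +
      topW w * epsW w * ∑ j, ((rpairSum (rows U top) (rows U (mid j)) : ℝ) + rpairSum (rows U (mid j)) (rows U top)) := by
  rw [sum_offDiag_PW (fun a b => lawW w a * lawW w b * (rpairSum (rows U a) (rows U b) : ℝ))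
    (fun b => by rw [rows_bot U hU hprop, rpairSum_empty_left]; simp)
    (fun a => by rw [rows_bot U hU hprop, rpairSum_empty_right]; simp)]
  simp only [lawW, muW, mul_sum, sum_add_distrib, mul_add]
  congr 1
  · exact sum_congr rfl fun q _ => by ring
  · congr 1
    all_goals exact sum_congr rfl fun j _ => by ring

include hU hprop hne in
/-- The atoms common to all members: `⊤` always, `⊥` never, `m_j` iff column `j` is full. [this work] -/
theorem mem_common_iff (a : PW w) : a ∈ univ.filter (fun a => ∀ i, a ∈ U i) ↔
    a = top ∨ ∃ j, a = mid j ∧ ∀ i, mid j ∈ U i := by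
  rw [mem_filter]
  simp only [mem_univ, true_and]
  cases a with
  | bot => simp only [reduceCtorEq, false_and, exists_false, or_false, iff_false, not_forall]
           exact ⟨0, bot_not_mem (hU 0) (hprop 0)⟩
  | top => simp only [true_or, iff_true]; exact fun i => top_mem_of_isUpperSet (hU i) (hne i)
  | mid j => simp

/-- The number of systems of representatives is at most `(w+2)^{n+1}`. [this work] -/
theorem card_piFinset_le : ((Fintype.piFinset U).card : ℝ) ≤ ((w : ℝ) + 2) ^ (n + 1) := by
  have h : (Fintype.piFinset U).card ≤ (w + 2) ^ (n + 1) := by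
    calc (Fintype.piFinset U).card ≤ (univ : Finset (Fin (n + 1) → PW w)).card := card_le_univ _
      _ = (w + 2) ^ (n + 1) := by rw [Finset.card_univ, Fintype.card_fun, Fintype.card_fin, PW.card_univ]
  exact_mod_cast h

/-- The tail bound in the form used below: `#S · ε³ (n+1)! ≤ (w+2)^{n+1} ε³ (n+1) n!`. [this work] -/
theorem tail_le : ((Fintype.piFinset U).card : ℝ) * (epsW w ^ 3 * (n + 1).factorial) ≤
    epsW w ^ 3 * (((w : ℝ) + 2) ^ (n + 1) * ((n : ℝ) + 1)) * n.factorial := by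
  have hε := epsW_pos w
  have hc := card_piFinset_le U
  rw [Nat.factorial_succ, Nat.cast_mul, Nat.cast_succ]
  have : (0 : ℝ) ≤ epsW w ^ 3 * (((n : ℝ) + 1) * n.factorial) := by positivity
  nlinarith

end Family

end SahiStrictHierarchy

end Summit.CriticalPhenomena.PercolationContinuityZ3.Theorems
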